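import Summits.ABC.IUTFork.Joshi.ATS4LocusUpperBounds

/-!
# Joshi, *Arithmetic Teichmüller Spaces IV* (arXiv:2403.10430v2) §6.8–§6.11 — a MODEL of the typed inputs (non-vacuity of the
# proved assembly of Thm 6.10.1)

Companion of `Joshi/ATS4LocusUpperBounds.lean` (abc-iut cell, branch E, rung LADDER-ABC:A2.E; seat abc-iut-E-t31, slot T-31). That
file PROVES `LocusVolumeDatum.thm6101_of_inputs`: the ten printed inputs of [J-IV] §6.8–§6.11 ((6.11.1), Prop 6.10.9 on `V^dst_ℚ`,
the component sums, Lemma 6.4.2 (2), (6.8.11), Lemma 6.7.8, the lower bound = Cor 9.11.1.1, the two Frobenius-shift equalities,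
«(1/2ℓ) log(q) = |log(q_ℓ)|») imply the displayed chain of Thm 6.10.1. Here: ONE explicit datum at which all ten inputs hold
(`toyDatum_inputs`), so the implication is not vacuous, and at which — by the proved assembly, not by hand — Thm 6.10.1's chain and
`C_Θ ≥ −1` hold (`toyDatum_thm6101`). The datum is a TOY (ℓ = 5, one distinguished prime, all volumes zero); it models the typed
SIGNATURE and nothing of the arithmetic of any curve. No side is taken on [IUTchIII] Cor. 3.12 or on any author; a model exhibits
satisfiability of reading predicates, nothing more. [claim: Joshi2024ATS4, status: disputed] (locators); the theorems are [folklore].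
-/

noncomputable section

namespace Summit.ABC.IUTFork.Joshi.ATS4

open LocusVolumeDatum

/-- A toy `LocusVolumeDatum`: `ℓ = 5` (`ℓ* = 2`), `d_mod = 1`, `e*_mod = 552960`, `η_prm = 60`, `log(d_{L_tpd}) = log(f_{L_tpd}) =
log(s_ℚ) = log(s^≤_ℚ) = 0`, `log(d_{L′}) = 5`, `log(q) = 50`, `V^dst_ℚ = {2}` carrying the whole of each component, all log-volumes
`0`, `|log(q_ℓ)| = 5 = (1/2ℓ)·log(q)` for both arithmeticoids. [folklore] -/
def toyDatum : LocusVolumeDatum where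
  l := 5
  five_le_l := le_rfl
  dmod := 1
  one_le_dmod := le_rfl
  estar := 552960
  estar_ge := le_rfl
  eta := 60
  eta_nonneg := by norm_num
  logDiffTpd := 0
  logDiffTpd_nonneg := le_rfl
  logCondTpd := 0
  logCondTpd_nonneg := le_rfl
  logDiffLp := 5
  logq := 50
  logq_nonneg := by norm_num
  logsQ := 0
  logsLe := 0
  Vdst := {2}
  logDiffLpAt := fun _ => 5
  logqAt := fun _ => 50
  logsQAt := fun _ => 0
  logsLeAt := fun _ => 0
  logVolAt := fun _ => 0
  logVolArch := 0
  logVolHull := 0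
  logVolHullFrob := 0
  absLogThetaQ := 5
  absLogThetaQ_pos := by norm_num
  absLogThetaQFrob := 5

/-- **All ten inputs of `thm6101_of_inputs` hold at the toy datum** (so the proved §6.11 assembly is not vacuous). [folklore] -/
theorem toyDatum_inputs :
    toyDatum.Eq6111 ∧ (∀ p ∈ toyDatum.Vdst, toyDatum.Prop6109 p) ∧ toyDatum.ComponentSums ∧ toyDatum.Lem642₂ ∧
      toyDatum.Eq6811 ∧ toyDatum.Lem678 ∧ toyDatum.LowerBound ∧ toyDatum.FrobShiftQ ∧ toyDatum.FrobShiftVol ∧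
      toyDatum.LogqDictionary := by
  have h5 : 0 ≤ Real.log 5 := Real.log_nonneg (by norm_num)
  have h150 : 0 ≤ Real.log 150 := Real.log_nonneg (by norm_num)
  refine ⟨?_, ?_, ?_, ?_, ?_, ?_, ?_, ?_, ?_, ?_⟩
  · simp [Eq6111, toyDatum]
  · intro p hp
    simp only [Prop6109, toyDatum, lstar, abs_zero, mul_zero]
    norm_num
  · simp [ComponentSums, toyDatum]
  · simp only [Lem642₂, toyDatum]; norm_num; linarith
  · simp only [Eq6811, toyDatum]; norm_num; exact h150
  · simp only [Lem678, toyDatum]; norm_num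
  · simp only [LowerBound, toyDatum, lstar, abs_zero, mul_zero]; norm_num
  · simp [FrobShiftQ, toyDatum]
  · simp [FrobShiftVol, toyDatum]
  · simp only [LogqDictionary, toyDatum]; norm_num

/-- Hence, BY THE PROVED ASSEMBLY, the displayed chain of Thm 6.10.1 and `C_Θ ≥ −1` hold at the toy datum. [folklore] -/
theorem toyDatum_thm6101 : toyDatum.Thm6101 ∧ -1 ≤ toyDatum.CTheta := by
  obtain ⟨h₁, h₂, h₃, h₄, h₅, h₆, h₇, h₈, h₉, hD⟩ := toyDatum_inputs
  have h := toyDatum.thm6101_of_inputs h₁ h₂ h₃ h₄ h₅ h₆ h₇ h₈ h₉ hD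
  exact ⟨h, toyDatum.neg_one_le_cTheta h⟩

end Summit.ABC.IUTFork.Joshi.ATS4

end
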